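import Summits.AtomisticToContinuum.Crystallization.Theorems.NashClassCertificatesNashHullBridge

/-!
# Crux `HullMinimality.LayeredWindows` (stmt-AtomisticToContinuum-11778), line `registered`:
# the by-name edges of the reduction graph (lead c4)

The line reduces the crux to two stubs (`Cruxes/LayeredWindows/Lines/registered.lean`):
S1 `stub_twoShellGoodWindows` (all-two-shell-good balls of every radius, eventually, along every
Lennard-Jones ground-state sequence) and S2 = item 16827 `NashClassCertificates.NashNearField`.
This file records, as theorems of the tree, the remaining edges between these stubs and the
NAMED open items of the neighbouring routes, so that the ledger's dependency graph is explicit: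

* `nashTwoShellGap_of_coerciveTwoShellGap` — `PhononSlackCertificates.CoerciveTwoShellGap`
  (stmt-13956, every separation `δ`) implies `NashClassCertificates.NashTwoShellGap` (stmt-16826,
  `δ = 1/3`, Nash hypothesis unused);
* `nashNearField_of_nearFieldConvexity` — `PhononSlackCertificates.NearFieldConvexity`
  (stmt-13958) implies `NashClassCertificates.NashNearField` (stmt-16827), same specialisation;
* `twoShellGoodWindows_of_nashTwoShellGap`, `twoShellGoodWindows_of_coerciveTwoShellGap` — the
  statement of stub S1 follows from either gap item (landed `goodWindows_of_nashTwoShellGap`);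
* `layeredWindows_of_coerciveTwoShellGap_of_nearFieldConvexity` — hence the crux from the two
  PhononSlack cruxes through the LOCALISED bridge (a second proof of the closed `HullBridge` 15147,
  by `layeredWindows_of_goodWindows` instead of the global clean-centre argument).
-/

noncomputable section

open scoped BigOperators Classical
open Filter Topology

namespace Summit.AtomisticToContinuum.Crystallization.Theorems.LayeredWindowsLocal

open Summit.AtomisticToContinuum.Crystallization.Theses
open Literature.MathematicalPhysics.StatisticalMechanics Literature.Geometry.DiscreteGeometry
open Summit.AtomisticToContinuum.Crystallization.Theorems.ChargedEnergyGapNegative (E3)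

/-- **Item 13956 implies item 16826**: the coercive two-shell gap at every separation `δ` gives the
gap on the Nash class (`δ = 1/3`; the best-response hypothesis is simply dropped). -/
theorem nashTwoShellGap_of_coerciveTwoShellGap (hCG : PhononSlackCertificates.CoerciveTwoShellGap) :
    NashClassCertificates.NashTwoShellGap := by
  obtain ⟨g, hg, hgap⟩ := hCG (1 / 3) (by norm_num)
  exact ⟨g, hg, fun N x hsep _ => hgap N x hsep⟩

/-- **Item 13958 implies item 16827**: the near-field convexity at every separation `δ` gives the
near field on the Nash class (`δ = 1/3`; the best-response hypothesis is simply dropped). -/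
theorem nashNearField_of_nearFieldConvexity (hNF : PhononSlackCertificates.NearFieldConvexity) :
    NashClassCertificates.NashNearField := by
  intro η hη
  obtain ⟨c, hc, C, hC⟩ := hNF (1 / 3) (by norm_num) η hη
  exact ⟨c, hc, C, fun N x hsep _ Ω hΩ => hC N x hsep Ω hΩ⟩

/-- **Stub S1 of the line from item 16826** (`NashTwoShellGap`): along every Lennard-Jones
ground-state sequence, all-two-shell-good balls of every radius exist eventually
(`goodWindows_of_nashTwoShellGap`, quantified over the sequence). -/
theorem twoShellGoodWindows_of_nashTwoShellGap (hG : NashClassCertificates.NashTwoShellGap) :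
    ∀ x : (N : ℕ) → (Fin N → E3), (∀ N, IsGroundState lennardJones (x N)) → ∀ ρ : ℝ,
      ∀ᶠ N : ℕ in atTop, ∃ i : Fin N, ∀ j : Fin N,
        dist (x N j) (x N i) ≤ ρ → IsTwoShellGood (1 / 20) (47 / 50) 1 (x N) j :=
  fun x hx ρ => goodWindows_of_nashTwoShellGap hG x hx ρ

/-- **Stub S1 of the line from item 13956** (`CoerciveTwoShellGap`). -/
theorem twoShellGoodWindows_of_coerciveTwoShellGap (hCG : PhononSlackCertificates.CoerciveTwoShellGap) :
    ∀ x : (N : ℕ) → (Fin N → E3), (∀ N, IsGroundState lennardJones (x N)) → ∀ ρ : ℝ,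
      ∀ᶠ N : ℕ in atTop, ∃ i : Fin N, ∀ j : Fin N,
        dist (x N j) (x N i) ≤ ρ → IsTwoShellGood (1 / 20) (47 / 50) 1 (x N) j :=
  twoShellGoodWindows_of_nashTwoShellGap (nashTwoShellGap_of_coerciveTwoShellGap hCG)

/-- **The crux from the two PhononSlack cruxes through the localised bridge**:
`CoerciveTwoShellGap → NearFieldConvexity → HullMinimality.LayeredWindows` (a second proof of the
matrix of the closed item `HullBridge` 15147, via `layeredWindows_of_goodWindows`). -/
theorem layeredWindows_of_coerciveTwoShellGap_of_nearFieldConvexity : Summit.AtomisticToContinuum.Crystallization.Theses.PhononSlackCertificates.CoerciveTwoShellGap → Summit.AtomisticToContinuum.Crystallization.Theses.PhononSlackCertificates.NearFieldConvexity → Summit.AtomisticToContinuum.Crystallization.Theses.HullMinimality.LayeredWindows :=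
  fun hCG hNF => layeredWindows_of_goodWindows (twoShellGoodWindows_of_coerciveTwoShellGap hCG)
    (nashNearField_of_nearFieldConvexity hNF)

end Summit.AtomisticToContinuum.Crystallization.Theorems.LayeredWindowsLocal

end
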